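import Summits.NavierStokesRegularity.NavierStokesRegularity.Theorems.RecurrentProfilesRecurrentReduction
import Summits.NavierStokesRegularity.NavierStokesRegularity.Theorems.SqueezeCycleRecurrentLiouvilleOrbitContinuous
import Literature.Dynamics.TopologicalDynamics.MinimalOrbitClosure
import Literature.Analysis.FluidPDE.ScalingUniformRecurrence
import HarnessLib

/-!
# Crux `ForcedSymmetry` (stmt-NavierStokesRegularity-4052), line `closing-dichotomy` (gen c10.1) —
# stub `stub_hullMinimal`: the `L³_loc` hull of a uniformly scaling-recurrent field is minimal

Theorems-only file (no definitions, no named facts), pure real analysis.  A field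
`W : ℝ → ℝ³ → ℝ³` "lies in `L³_loc`" if `W ∈ L³(Q(0, R))` for every `R > 0`
(`Q(0, R) = ]-R², 0[ × B(0, R)`, `parabolicCylinder R 0`); `W_c = nsRescale c W`,
`W_c(t, x) = c W(c² t, c x)`, is its Navier–Stokes rescaling and `σ ↦ W_{e^σ}` the scaling flow.
`V` is a HULL POINT of `U` if for every `ε > 0` and every compact `K ⊆ {t ≤ 0} × ℝ³` some orbit
point `U_{e^τ}` is `ε`-close to `V` in `L³(K)`.  `stub_hullMinimal`: if `U, V ∈ L³_loc`, `U` is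
uniformly recurrent under the scaling flow (the clause of `IsScalingUniformlyRecurrent`: the
`ε`-return log-scales of `U` on every compact `K` are relatively dense) and `V` is a hull point of
`U`, then `U` is a hull point of `V` — the hull `H(U)` is a MINIMAL set of the scaling flow
(Furstenberg 1981, Thm. 1.17: the orbit closure of a uniformly recurrent point is minimal).

Proof: Furstenberg's argument for Thm. 1.17, made quantitative in `L³_loc` (the closed set
`{z | ∃ k ∈ [0, L], ϕ_k z ∈ V̄}` of that proof — closed by joint continuity and compactness of the
window `[0, L]` — is replaced by the uniform Lipschitz bound `e^L` of the scaling maps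
`W ↦ W_{e^k}`, `k ∈ [0, L]`, from `L³(Q(0, e^L R))` to `L³(Q(0, R))`, i.e. by the exact scaling
law).  Given `ε > 0` and a compact `K ⊆ {t ≤ 0} × ℝ³`:
0. `‖F‖_{L³(K)} ≤ ‖F‖_{L³(Q(0, R))}` for all `F`, with `R = n + 1`
   (`exists_eLpNorm_restrict_le_of_isCompact`: `K ⊆ Q(0, R)` up to the null hyperplane `{t = 0}`).
1. Uniform recurrence of `U` with `ε/2` on the compact closure of `Q(0, R)`: a window length `L`.
2. The hull hypothesis with `ε/(2 e^L)` on the compact closure of `Q(0, e^L R)`: an orbit point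
   `U_{e^{τ₀}}` with `‖U_{e^{τ₀}} − V‖_{L³(Q(0, e^L R))} ≤ ε/(2 e^L)`.
3. The window `[τ₀, τ₀ + L]` contains a return log-scale `σ`: `‖U_{e^σ} − U‖_{L³(Q(0,R))} ≤ ε/2`.
4. With `c = e^{σ − τ₀} ∈ [1, e^L]`: `(U_{e^{τ₀}})_c = U_{e^σ}` (group law `nsRescale_mul`) and
   `‖V_c − U_{e^σ}‖_{L³(Q(0,R))} = c (c⁵)^{-1/3} ‖V − U_{e^{τ₀}}‖_{L³(Q(0, cR))} ≤ e^L · ε/(2e^L)`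
   (exact scaling law `eLpNorm_zoom_sub_zoom`, `nsRescale_eq_zoom`, `Q(0, cR) ⊆ Q(0, e^L R)`).
5. Minkowski: `‖V_{e^{σ − τ₀}} − U‖_{L³(K)} ≤ ‖V_c − U_{e^σ}‖ + ‖U_{e^σ} − U‖ ≤ ε` on `Q(0, R)`.

## References

* H. Furstenberg, *Recurrence in Ergodic Theory and Combinatorial Number Theory*, Princeton UP
  (1981), Ch. 1 §4, Thm. 1.17. [Furstenberg1981]
* J. Auslander, *Minimal Flows and their Extensions*, North-Holland (1988), Ch. 1, Thm. 7.
  [Auslander1988]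
-/

noncomputable section

-- the sub-problem namespace repeats the summit name (D-0017 layout `Summit.<S>.<P>.Theorems`)
set_option linter.dupNamespace false

namespace Summit.NavierStokesRegularity.NavierStokesRegularity.Theorems

open MeasureTheory Set Function Filter Topology TopologicalSpace Metric
open Literature.Analysis Literature.Analysis.FluidPDE
open scoped NNReal ENNReal

/-- Local notation for physical space `ℝ³ = EuclideanSpace ℝ (Fin 3)` (the registered stub
signature is spelled with it). -/
local notation "ℝ³" => EuclideanSpace ℝ (Fin 3)

/-! ### Bookkeeping lemmas -/

/-- The closure of a backward parabolic ball `Q(0, R)` is a compact subset of the closed lower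
half-space `{t ≤ 0} × ℝ³` (it lies in the box `[-R², 0] × B̄(0, R)`). [folklore] -/
private theorem hullMin_closure_cylinder (R : ℝ) :
    IsCompact (closure (parabolicCylinder R (0 : ℝ × ℝ³))) ∧
      closure (parabolicCylinder R (0 : ℝ × ℝ³)) ⊆ Set.Iic (0 : ℝ) ×ˢ Set.univ := by
  have hsub : closure (parabolicCylinder R (0 : ℝ × ℝ³)) ⊆
      Icc ((0 : ℝ × ℝ³).1 - R ^ 2) (0 : ℝ × ℝ³).1 ×ˢ closedBall (0 : ℝ × ℝ³).2 R := by
    rw [parabolicCylinder, closure_prod_eq]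
    exact prod_mono (isClosed_Icc.closure_subset_iff.2 Ioo_subset_Icc_self)
      closure_ball_subset_closedBall
  refine ⟨(isCompact_Icc.prod (isCompact_closedBall _ _)).of_isClosed_subset isClosed_closure hsub,
    hsub.trans ?_⟩
  rintro z ⟨hz1, -⟩
  exact ⟨hz1.2, mem_univ _⟩

/-- The scaling constant `c (c⁵)^{-1/3}` of `eLpNorm_zoom_sub_zoom` is at most `M` for
`1 ≤ c ≤ M` (indeed it is `c^{-2/3} ≤ 1`). [folklore] -/
private theorem hullMin_zoomConst_le {c M : ℝ} (hc1 : 1 ≤ c) (hcM : c ≤ M) :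
    ‖c‖ₑ * (ENNReal.ofReal (c ^ 2 * c ^ 3)⁻¹) ^ (1 / (3 : ℝ≥0∞).toReal) ≤ ENNReal.ofReal M := by
  have hc0 : 0 < c := one_pos.trans_le hc1
  have h1 : ‖c‖ₑ ≤ ENNReal.ofReal M := by
    rw [Real.enorm_eq_ofReal hc0.le]
    exact ENNReal.ofReal_le_ofReal hcM
  have h2 : (ENNReal.ofReal (c ^ 2 * c ^ 3)⁻¹) ^ (1 / (3 : ℝ≥0∞).toReal) ≤ 1 := by
    refine ENNReal.rpow_le_one (ENNReal.ofReal_le_one.2 ?_) (by norm_num)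
    exact inv_le_one_of_one_le₀
      (one_le_mul_of_one_le_of_one_le (one_le_pow₀ hc1) (one_le_pow₀ hc1))
  calc ‖c‖ₑ * (ENNReal.ofReal (c ^ 2 * c ^ 3)⁻¹) ^ (1 / (3 : ℝ≥0∞).toReal)
      ≤ ENNReal.ofReal M * 1 := mul_le_mul' h1 h2
    _ = ENNReal.ofReal M := mul_one _

/-- **The Lipschitz step (exact scaling law).**  For fields `V, W`, `1 ≤ c ≤ M` and `R ≥ 0`:
`‖V_c − W_c‖_{L³(Q(0,R))} ≤ M ‖V − W‖_{L³(closure Q(0, M R))}`, since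
`‖V_c − W_c‖_{L³(Q(0,R))} = c (c⁵)^{-1/3} ‖V − W‖_{L³(Q(0, cR))}` (`eLpNorm_zoom_sub_zoom`,
`nsRescale_eq_zoom`) and `Q(0, cR) ⊆ Q(0, MR)`. [folklore] -/
private theorem hullMin_lipschitz (V W : ℝ → ℝ³ → ℝ³) {c M R : ℝ} (hc1 : 1 ≤ c) (hcM : c ≤ M)
    (hR : 0 ≤ R) :
    eLpNorm (uncurry (nsRescale c V) - uncurry (nsRescale c W)) 3
        (volume.restrict (parabolicCylinder R (0 : ℝ × ℝ³))) ≤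
      ENNReal.ofReal M * eLpNorm (uncurry V - uncurry W) 3
        (volume.restrict (closure (parabolicCylinder (M * R) (0 : ℝ × ℝ³)))) := by
  have hc0 : 0 < c := one_pos.trans_le hc1
  rw [nsRescale_eq_zoom c V, nsRescale_eq_zoom c W, eLpNorm_zoom_sub_zoom V W hc0 R]
  refine mul_le_mul' (hullMin_zoomConst_le hc1 hcM)
    (eLpNorm_mono_measure _ (Measure.restrict_mono ?_ le_rfl))
  exact (SuitableCompactness.parabolicCylinder_zero_mono (by positivity)
    (mul_le_mul_of_nonneg_right hcM hR)).trans subset_closure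

/-! ### The stub -/

/-- **Stub `stub_hullMinimal` of line `closing-dichotomy` (crux `ForcedSymmetry`, gen c10.1): the
hull of a uniformly scaling-recurrent field is a MINIMAL set.**  If `U, V ∈ L³_loc` (i.e. in
`L³(Q(0, R))` for all `R > 0`), `U` is uniformly recurrent under the scaling flow
`σ ↦ U_{e^σ} = nsRescale (exp σ) U` in `L³_loc({t ≤ 0} × ℝ³)` (the `ε`-return log-scales on every
compact `K ⊆ {t ≤ 0} × ℝ³` are relatively dense) and `V` is a hull point of `U` (every
`L³(K)`-neighbourhood of `V` contains an orbit point `U_{e^τ}`), then `U` is a hull point of `V`.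
Proof: Furstenberg's Thm. 1.17 made quantitative — reduce `K` to a ball `Q(0, R)`
(`exists_eLpNorm_restrict_le_of_isCompact`); take the window length `L` of the `ε/2`-returns of
`U` on `Q(0, R)`; approximate `V` by `U_{e^{τ₀}}` within `ε/(2e^L)` on `Q(0, e^L R)`; pick a return
log-scale `σ ∈ [τ₀, τ₀ + L]`; then `c = e^{σ − τ₀} ∈ [1, e^L]`, `(U_{e^{τ₀}})_c = U_{e^σ}`
(`nsRescale_mul`), `‖V_c − U_{e^σ}‖_{L³(Q(0,R))} ≤ e^L ‖V − U_{e^{τ₀}}‖_{L³(Q(0, e^L R))} ≤ ε/2` by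
the exact scaling law (`eLpNorm_zoom_sub_zoom`), and `‖U_{e^σ} − U‖_{L³(Q(0,R))} ≤ ε/2`; Minkowski.
[cite: Furstenberg1981, Ch. 1 §4, Thm. 1.17] -/
theorem stub_hullMinimal :
    ∀ (U V : ℝ → ℝ³ → ℝ³),
      (∀ R : ℝ, 0 < R → MemLp (uncurry U) 3 (volume.restrict (parabolicCylinder R (0 : ℝ × ℝ³)))) →
      (∀ R : ℝ, 0 < R → MemLp (uncurry V) 3 (volume.restrict (parabolicCylinder R (0 : ℝ × ℝ³)))) →
      (∀ ε : ℝ, 0 < ε → ∀ K : Set (ℝ × ℝ³), IsCompact K → K ⊆ Set.Iic (0 : ℝ) ×ˢ Set.univ →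
        ∃ L : ℝ, 0 < L ∧ ∀ a : ℝ, ∃ σ ∈ Set.Icc a (a + L),
          eLpNorm (fun z : ℝ × ℝ³ => nsRescale (Real.exp σ) U z.1 z.2 - U z.1 z.2) 3
            (volume.restrict K) ≤ ENNReal.ofReal ε) →
      (∀ ε : ℝ, 0 < ε → ∀ K : Set (ℝ × ℝ³), IsCompact K → K ⊆ Set.Iic (0 : ℝ) ×ˢ Set.univ →
        ∃ τ : ℝ, eLpNorm (fun z : ℝ × ℝ³ => nsRescale (Real.exp τ) U z.1 z.2 - V z.1 z.2) 3
          (volume.restrict K) ≤ ENNReal.ofReal ε) →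
      ∀ ε : ℝ, 0 < ε → ∀ K : Set (ℝ × ℝ³), IsCompact K → K ⊆ Set.Iic (0 : ℝ) ×ˢ Set.univ →
        ∃ τ : ℝ, eLpNorm (fun z : ℝ × ℝ³ => nsRescale (Real.exp τ) V z.1 z.2 - U z.1 z.2) 3
          (volume.restrict K) ≤ ENNReal.ofReal ε := by
  intro U V hU hV hrec hhull ε hε K hK hKH
  -- Step 0: `L³(K) ≤ L³(Q(0, R))` with `R = n + 1`
  obtain ⟨n, hn⟩ := exists_eLpNorm_restrict_le_of_isCompact hK hKH
  set R : ℝ := (n : ℝ) + 1 with hR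
  have hR0 : 0 < R := by positivity
  -- Step 1: a window length `L` for the `ε/2`-returns of `U` on (the closure of) `Q(0, R)`
  obtain ⟨L, -, hwin⟩ := hrec (ε / 2) (half_pos hε) _ (hullMin_closure_cylinder R).1
    (hullMin_closure_cylinder R).2
  -- Step 2: an orbit point `U_{e^{τ₀}}` that is `ε/(2e^L)`-close to `V` on `Q(0, e^L R)`
  have hδ : 0 < ε / 2 / Real.exp L := div_pos (half_pos hε) (Real.exp_pos L)
  obtain ⟨τ₀, hτ₀⟩ := hhull (ε / 2 / Real.exp L) hδ _
    (hullMin_closure_cylinder (Real.exp L * R)).1 (hullMin_closure_cylinder (Real.exp L * R)).2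
  -- Step 3: a return log-scale `σ` of `U` in the window `[τ₀, τ₀ + L]`
  obtain ⟨σ, hσ, hσε⟩ := hwin τ₀
  -- Step 4: `τ = σ - τ₀` does it; `c = e^{σ - τ₀} ∈ [1, e^L]`
  set c : ℝ := Real.exp (σ - τ₀) with hc
  have hc0 : 0 < c := Real.exp_pos _
  have hc1 : 1 ≤ c := Real.one_le_exp (sub_nonneg.2 hσ.1)
  have hcL : c ≤ Real.exp L := Real.exp_le_exp.2 (by linarith [hσ.2])
  -- the group law `(U_{e^{τ₀}})_c = U_{e^σ}`
  have hgrp : nsRescale c (nsRescale (Real.exp τ₀) U) = nsRescale (Real.exp σ) U := by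
    rw [hc, ← nsRescale_mul, ← Real.exp_add, add_sub_cancel]
  -- measurability of the three fields on `Q(0, R)`
  have hmU : AEStronglyMeasurable (uncurry U)
      (volume.restrict (parabolicCylinder R (0 : ℝ × ℝ³))) := (hU R hR0).1
  have hmσ : AEStronglyMeasurable (uncurry (nsRescale (Real.exp σ) U))
      (volume.restrict (parabolicCylinder R (0 : ℝ × ℝ³))) := by
    rw [nsRescale_eq_zoom]
    exact (memLp_three_zoom (Real.exp_pos σ) (hU _ (by positivity))).1
  have hmV : AEStronglyMeasurable (uncurry (nsRescale c V))
      (volume.restrict (parabolicCylinder R (0 : ℝ × ℝ³))) := by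
    rw [nsRescale_eq_zoom]
    exact (memLp_three_zoom hc0 (hV _ (by positivity))).1
  have hmW : AEStronglyMeasurable (uncurry (nsRescale c (nsRescale (Real.exp τ₀) U)))
      (volume.restrict (parabolicCylinder R (0 : ℝ × ℝ³))) := by
    rw [hgrp]
    exact hmσ
  -- Term 1: the Lipschitz step, `‖V_c − (U_{e^{τ₀}})_c‖_{L³(Q(0,R))} ≤ e^L · ε/(2e^L)`
  have hT1 : eLpNorm (uncurry (nsRescale c V) - uncurry (nsRescale c (nsRescale (Real.exp τ₀) U))) 3
      (volume.restrict (parabolicCylinder R (0 : ℝ × ℝ³))) ≤ ENNReal.ofReal (ε / 2) := by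
    refine (hullMin_lipschitz V _ hc1 hcL hR0.le).trans ?_
    have h2 : eLpNorm (uncurry V - uncurry (nsRescale (Real.exp τ₀) U)) 3
        (volume.restrict (closure (parabolicCylinder (Real.exp L * R) (0 : ℝ × ℝ³)))) ≤
        ENNReal.ofReal (ε / 2 / Real.exp L) := by
      rw [eLpNorm_sub_comm]
      exact hτ₀
    calc ENNReal.ofReal (Real.exp L) * eLpNorm (uncurry V - uncurry (nsRescale (Real.exp τ₀) U)) 3
          (volume.restrict (closure (parabolicCylinder (Real.exp L * R) (0 : ℝ × ℝ³))))
        ≤ ENNReal.ofReal (Real.exp L) * ENNReal.ofReal (ε / 2 / Real.exp L) :=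
          mul_le_mul' le_rfl h2
      _ = ENNReal.ofReal (ε / 2) := by
          rw [← ENNReal.ofReal_mul (Real.exp_pos L).le, mul_div_cancel₀ _ (Real.exp_pos L).ne']
  -- Term 2: the return, `‖U_{e^σ} − U‖_{L³(Q(0,R))} ≤ ε/2`
  have hT2 : eLpNorm (uncurry (nsRescale (Real.exp σ) U) - uncurry U) 3
      (volume.restrict (parabolicCylinder R (0 : ℝ × ℝ³))) ≤ ENNReal.ofReal (ε / 2) :=
    (eLpNorm_mono_measure _ (Measure.restrict_mono subset_closure le_rfl)).trans hσε
  -- Minkowski on `Q(0, R)`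
  refine ⟨σ - τ₀, (hn (fun z : ℝ × ℝ³ => nsRescale c V z.1 z.2 - U z.1 z.2) 3).trans ?_⟩
  have e : (fun z : ℝ × ℝ³ => nsRescale c V z.1 z.2 - U z.1 z.2) =
      (uncurry (nsRescale c V) - uncurry (nsRescale c (nsRescale (Real.exp τ₀) U))) +
        (uncurry (nsRescale (Real.exp σ) U) - uncurry U) := by
    rw [hgrp, sub_add_sub_cancel]
    rfl
  rw [e]
  calc eLpNorm ((uncurry (nsRescale c V) - uncurry (nsRescale c (nsRescale (Real.exp τ₀) U))) +
          (uncurry (nsRescale (Real.exp σ) U) - uncurry U)) 3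
        (volume.restrict (parabolicCylinder R (0 : ℝ × ℝ³)))
      ≤ eLpNorm (uncurry (nsRescale c V) - uncurry (nsRescale c (nsRescale (Real.exp τ₀) U))) 3
            (volume.restrict (parabolicCylinder R (0 : ℝ × ℝ³))) +
          eLpNorm (uncurry (nsRescale (Real.exp σ) U) - uncurry U) 3
            (volume.restrict (parabolicCylinder R (0 : ℝ × ℝ³))) :=
        eLpNorm_add_le (hmV.sub hmW) (hmσ.sub hmU) (by norm_num)
    _ ≤ ENNReal.ofReal (ε / 2) + ENNReal.ofReal (ε / 2) := add_le_add hT1 hT2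
    _ = ENNReal.ofReal ε := by
        rw [← ENNReal.ofReal_add (half_pos hε).le (half_pos hε).le, add_halves]

end Summit.NavierStokesRegularity.NavierStokesRegularity.Theorems
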